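import Mathlib
import Summits.CriticalPhenomena.CardyFormulaZ2.Theorems.CardySelfRefinementDefs
import Summits.CriticalPhenomena.CardyFormulaZ2.Theorems.CardySelfRefinementGradientComparabilityStubCornerWindowsSections
import HarnessLib

/-!
# Crux `GradientComparability` (stmt-CriticalPhenomena-10269), line `monotone-product-coordinates` —
# support for stub `stub_cornerWindows`, part 2: the selector influence as a signed sum over the
# `2^k` sub-edge patterns of its bundle, and `|∂ρP| ≤ (½ − 2^{-k}) · Σ_bundles M_k(bundle set-pivotal)`

Route `CardySelfRefinement`, sub-problem `CriticalPhenomena/CardyFormulaZ2`; vocabulary from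
`CardySelfRefinementDefs` (`ax tb opn cfg prm M Aloc window coinWindow edgeOf P Dρ`); bundle surgery
and sections from part 1 (`…StubCornerWindowsSections`).

## Mathematics

By the signed Russo dictionary (`stub_Drho_eq_signed_sum`) `∂ρP = Σ_selectors infl(σ)`,
`infl(σ) = P(E | σ on) − P(E | σ off)`, `E = cfg k ⁻¹' Aloc`.  For the bundle `(t, d)` with
sub-edges `e_j = edgeOf (w j, d)`, `B = {e_j}`, sections `A^C = {ω | (ω ∖ B) ∪ C ∈ Aloc}`:
with the selector OFF every sub-edge reads its own fair coin, so (`real_sdiff_selector_eq_sum_patterns`)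
`P(E | σ off) = 2^{-k} Σ_{J ⊆ [k]} M(A^J)`, and with part 1 the **pattern formula**
(`selectorInfl_eq_sections`), valid at EVERY parameter point, `ρ = 1` included:

`infl(σ_{t,d}) = ½ M(A^B) + ½ M(A^∅) − 2^{-k} Σ_{J ⊆ [k]} M(A^J)`, `M = M_k(ρ,c)`,

i.e. minus the "untie influence" of the corner-patch reduction (`Drho_one_eq_sum_untie`).  Since
`A^∅ ⊆ A^J ⊆ A^B` (`Aloc` is increasing) this is the **defect form**
(`selectorInfl_eq_half_pivotal_sub_defect`)

`infl(σ_{t,d}) = ½ M(B set-pivotal) − 2^{-k} Σ_{J ⊆ [k]} M(A^J ∖ A^∅)`,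
`{B set-pivotal} = {ω ∪ B ∈ Aloc, ω ∖ B ∉ Aloc} = A^B ∖ A^∅`,

whence the sharp two-sided bound `|infl(σ_{t,d})| ≤ (½ − 2^{-k}) M(B set-pivotal)`
(`abs_selectorInfl_le`; equality `+` when almost surely every proper pattern is as bad as the closed
bundle — the bulk situation on the slice `c = 0`, where partial patterns dangle —,
`selectorInfl_eq_of_defect_zero`; equality `−` for the OR-patterns of boundary bundles), and,
summing over the selectors of the coin window, the registered sub-goal
`abs_Drho_le_sum_bundlePivotal`: for `0 < k`, `η ≠ 0`, `ρ ∈ [0,1]`, any `c`,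

`|∂ρP(ρ,c)| ≤ (½ − 2^{-k}) · Σ_{bundles (t,d) of the window} M_k(ρ,c)(bundle (t,d) set-pivotal for Aloc)`.

Unlike Stage A (`abs_Drho_le_sum_axial_pivotal`, constant `2^k/(1-ρ)`) this holds AT the corner
`ρ = 1`, where `∂ρP` is the one-sided derivative entering the two Kesten windows `stub_cornerWindows`:
it is the upper half of "`|∂ρP| ≍` number of pivotal bundles" on both slices through `(1,0)`.
(Grimmett 1999 Thm 2.25 / Russo 1981 §4 Lemma 3: Russo's formula and conditioning on a block.)
-/

noncomputable section

namespace Summit.CriticalPhenomena.CardyFormulaZ2.Theorems.CardySelfRefinement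

open scoped Topology
open Filter Set MeasureTheory
open Literature.Probability.LatticeModels Literature.Probability.Percolation
open Literature.Probability.Percolation.QuadCrossing
open Summit.CriticalPhenomena.CardyFormulaZ2.Theses.CardySelfRefinement

/-- **Selector forced OFF**: `P{S | S ∖ σ ∈ E} = 2^{-k} Σ_{J ⊆ [k]} M((ω ∖ B) ∪ {e_j | j ∈ J} ∈ Aloc)`
(condition on the `k` fair own coins, independent of the section events). -/
theorem real_sdiff_selector_eq_sum_patterns (k m : ℕ) (F : Fin m → Quad (Set.univ : Set ℂ)) {η : ℝ}
    (hη : η ≠ 0) {t : Site 2} {d : Fin 2} {w : ℕ → Site 2}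
    (hw₁ : ∀ j, j < k → ax k (w j, d) ∧ tb k (w j, d) = t)
    (hw₂ : ∀ v : Site 2, ax k (v, d) → tb k (v, d) = t → ∃ j, j < k ∧ v = w j)
    (hw₃ : ∀ j j', j < k → j' < k → w j = w j' → j = j')
    {B : Finset (Sym2 (Site 2))} (hB : B = (Finset.range k).image fun j => edgeOf (w j, d))
    (ρ c : ℝ) :
    (prodBernoulli (prm k ρ c)).real {S | S \ {(t, d, (2 : Fin 3))} ∈ (cfg k) ⁻¹' Aloc m F η} =
      (1 / 2) ^ k * ∑ J ∈ (Finset.range k).powerset,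
        (M k ρ c).real {ω | ω \ ↑B ∪ ↑(J.image fun j => edgeOf (w j, d)) ∈ Aloc m F η} := by
  classical
  set μ := prodBernoulli (prm k ρ c) with hμ
  set own : ℕ → Site 2 × Fin 2 × Fin 3 := fun j => (w j, d, (0 : Fin 3)) with hown
  set O : Finset (Site 2 × Fin 2 × Fin 3) := (Finset.range k).image own with hO
  set sub : ℕ → Sym2 (Site 2) := fun j => edgeOf (w j, d) with hsub
  set X : Finset ℕ → Set (Set (Site 2 × Fin 2 × Fin 3)) :=
    fun J => {S | cfg k S \ ↑B ∪ ↑(J.image sub) ∈ Aloc m F η} with hX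
  set Cyl : Finset ℕ → Set (Set (Site 2 × Fin 2 × Fin 3)) :=
    fun J => {S | ∀ j, j < k → (own j ∈ S ↔ j ∈ J)} with hCyl
  set Y : Set (Set (Site 2 × Fin 2 × Fin 3)) :=
    {S | S \ {(t, d, (2 : Fin 3))} ∈ (cfg k) ⁻¹' Aloc m F η} with hY
  have hown_inj : ∀ j j', j < k → j' < k → own j = own j' → j = j' := by
    intro j j' hj hj' h
    simp only [hown, Prod.mk.injEq, and_true] at h
    exact hw₃ j j' hj hj' h
  have hXm : ∀ J, MeasurableSet (X J) := fun J =>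
    measurable_cfg k (measurableSet_section_bundle m F hη ↑B ↑(J.image sub))
  have hXdet : ∀ J, DeterminedBy (X J) (↑O : Set (Site 2 × Fin 2 × Fin 3))ᶜ := by
    intro J
    refine (determinedBy_preimage_section_bundle k m F η hw₂ hB ↑(J.image sub)).mono ?_
    refine Set.compl_subset_compl.2 ?_
    rw [hO]
    exact_mod_cast (Finset.subset_insert _ _).trans (Finset.subset_insert _ _)
  -- the pattern cylinders
  have hCyl_eq : ∀ J, J ⊆ Finset.range k →
      Cyl J = localCylinder (↑O : Set (Site 2 × Fin 2 × Fin 3)) ↑(J.image own) := by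
    intro J hJ
    ext S
    simp only [hCyl, Set.mem_setOf_eq, localCylinder, hO, Finset.coe_image, Finset.coe_range,
      Set.mem_image, Set.mem_Iio, Finset.mem_coe]
    constructor
    · rintro h i ⟨j, hj, rfl⟩
      rw [h j hj]
      constructor
      · exact fun hjJ => ⟨j, hjJ, rfl⟩
      · rintro ⟨j', hj', hjj'⟩
        rwa [← hown_inj j' j (Finset.mem_range.1 (hJ hj')) hj hjj']
    · intro h j hj
      rw [h (own j) ⟨j, hj, rfl⟩]
      constructor
      · rintro ⟨j', hj', hjj'⟩
        rwa [← hown_inj j' j (Finset.mem_range.1 (hJ hj')) hj hjj']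
      · exact fun hjJ => ⟨j, hjJ, rfl⟩
  have hCylm : ∀ J, J ⊆ Finset.range k → MeasurableSet (Cyl J) := fun J hJ => by
    rw [hCyl_eq J hJ]
    exact measurableSet_localCylinder O.countable_toSet _
  have hCyldet : ∀ J, DeterminedBy (Cyl J) (↑O : Set (Site 2 × Fin 2 × Fin 3)) := by
    intro J
    rw [determinedBy_iff]
    intro S₁ S₂ hS
    have h : ∀ j, j < k → (own j ∈ S₁ ↔ own j ∈ S₂) := by
      intro j hj
      have hx : own j ∈ (↑O : Set (Site 2 × Fin 2 × Fin 3)) := by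
        rw [hO, Finset.coe_image]
        exact ⟨j, Finset.mem_coe.2 (Finset.mem_range.2 hj), rfl⟩
      exact ⟨fun h1 => ((Set.ext_iff.1 hS _).1 ⟨h1, hx⟩).1, fun h2 => ((Set.ext_iff.1 hS _).2 ⟨h2, hx⟩).1⟩
    simp only [hCyl, Set.mem_setOf_eq]
    exact forall₂_congr fun j hj => by rw [h j hj]
  have hCyl_real : ∀ J, J ⊆ Finset.range k → μ.real (Cyl J) = (1 / 2) ^ k := by
    intro J hJ
    have hcard : O.card = k := by
      rw [hO, Finset.card_image_of_injOn, Finset.card_range]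
      intro j hj j' hj' h
      exact hown_inj j j' (Finset.mem_range.1 (Finset.mem_coe.1 hj))
        (Finset.mem_range.1 (Finset.mem_coe.1 hj')) h
    rw [hCyl_eq J hJ, hμ, prodBernoulli_real_localCylinder,
      show ((1 : ℝ) / 2) ^ k = ∏ _i ∈ O, (1 / 2 : ℝ) by rw [Finset.prod_const, hcard]]
    refine Finset.prod_congr rfl fun i hi => ?_
    obtain ⟨j, hj, rfl⟩ := Finset.mem_image.1 hi
    have hval : (prm k ρ c (own j) : ℝ) = 1 / 2 := by
      simp [hown, prm, (hw₁ j (Finset.mem_range.1 hj)).1]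
    rw [hval]
    split_ifs <;> norm_num
  -- on the cylinder of the pattern `J` the selector-off sample reads the pattern `J`
  have hsec : ∀ J, J ⊆ Finset.range k → Cyl J ∩ Y = Cyl J ∩ X J := by
    intro J hJ
    ext S
    simp only [Set.mem_inter_iff, and_congr_right_iff]
    intro hS
    have hfilter : ((Finset.range k).filter fun j => (w j, d, (0 : Fin 3)) ∈ S) = J := by
      ext j
      simp only [Finset.mem_filter, Finset.mem_range]
      constructor
      · rintro ⟨hj, hjS⟩
        exact (hS j hj).1 hjS
      · intro hjJ
        have hj := Finset.mem_range.1 (hJ hjJ)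
        exact ⟨hj, (hS j hj).2 hjJ⟩
    simp only [hY, hX, Set.mem_setOf_eq, Set.mem_preimage, cfg_sdiff_selector_eq k hw₁ hw₂ hw₃ hB S,
      hfilter]
    exact Iff.rfl
  -- the cylinders partition the selector-off event
  have hcover : Y = ⋃ J ∈ (Finset.range k).powerset, (Cyl J ∩ Y) := by
    ext S
    simp only [Set.mem_iUnion, Set.mem_inter_iff, exists_prop]
    constructor
    · intro hS
      refine ⟨(Finset.range k).filter fun j => own j ∈ S, Finset.mem_powerset.2 (Finset.filter_subset _ _),
        fun j hj => ?_, hS⟩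
      simp only [Finset.mem_filter, Finset.mem_range, hj, true_and]
    · rintro ⟨J, -, -, hS⟩
      exact hS
  have hdisj : (↑(Finset.range k).powerset : Set (Finset ℕ)).PairwiseDisjoint fun J => Cyl J ∩ Y := by
    intro J hJ J' hJ' hJJ'
    refine Set.disjoint_left.2 fun S hS hS' => hJJ' ?_
    ext j
    by_cases hj : j < k
    · rw [← hS.1 j hj, ← hS'.1 j hj]
    · have hJk := Finset.mem_powerset.1 (Finset.mem_coe.1 hJ)
      have hJ'k := Finset.mem_powerset.1 (Finset.mem_coe.1 hJ')
      constructor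
      · exact fun h => absurd (Finset.mem_range.1 (hJk h)) hj
      · exact fun h => absurd (Finset.mem_range.1 (hJ'k h)) hj
  have hYm : MeasurableSet Y :=
    measurable_sdiff_pt _ (measurable_cfg k (measurableSet_Aloc m F hη))
  show μ.real Y = _
  rw [hcover, measureReal_biUnion_finset hdisj fun J hJ =>
    (hCylm J (Finset.mem_powerset.1 hJ)).inter hYm, Finset.mul_sum]
  refine Finset.sum_congr rfl fun J hJ => ?_
  have hJ' := Finset.mem_powerset.1 hJ
  rw [hsec J hJ', prodBernoulli_real_inter_of_determinedBy _ O (hCyldet J) (hXdet J) (hCylm J hJ') (hXm J),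
    hCyl_real J hJ']
  simp only [hX]
  rw [real_preimage_section_bundle k m F hη ρ c]

/-! ## The pattern formula, its defect form, and the two-sided bound -/

/-- **Pattern formula for the selector influence** (any `ρ, c`; `η ≠ 0`):
`P(E | σ on) − P(E | σ off) = ½ M(ω ∪ B ∈ Aloc) + ½ M(ω ∖ B ∈ Aloc) − 2^{-k} Σ_{J ⊆ [k]} M(A^J)`. -/
theorem selectorInfl_eq_sections (k m : ℕ) (F : Fin m → Quad (Set.univ : Set ℂ)) {η : ℝ}
    (hη : η ≠ 0) {t : Site 2} {d : Fin 2} {w : ℕ → Site 2}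
    (hw₁ : ∀ j, j < k → ax k (w j, d) ∧ tb k (w j, d) = t)
    (hw₂ : ∀ v : Site 2, ax k (v, d) → tb k (v, d) = t → ∃ j, j < k ∧ v = w j)
    (hw₃ : ∀ j j', j < k → j' < k → w j = w j' → j = j')
    {B : Finset (Sym2 (Site 2))} (hB : B = (Finset.range k).image fun j => edgeOf (w j, d))
    (ρ c : ℝ) :
    (prodBernoulli (prm k ρ c)).real {S | insert (t, d, (2 : Fin 3)) S ∈ (cfg k) ⁻¹' Aloc m F η} -
        (prodBernoulli (prm k ρ c)).real {S | S \ {(t, d, (2 : Fin 3))} ∈ (cfg k) ⁻¹' Aloc m F η} =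
      1 / 2 * (M k ρ c).real {ω | ω ∪ ↑B ∈ Aloc m F η} +
        1 / 2 * (M k ρ c).real {ω | ω \ ↑B ∈ Aloc m F η} -
        (1 / 2) ^ k * ∑ J ∈ (Finset.range k).powerset,
          (M k ρ c).real {ω | ω \ ↑B ∪ ↑(J.image fun j => edgeOf (w j, d)) ∈ Aloc m F η} := by
  rw [real_insert_selector_eq_sections k m F hη hw₁ hw₂ hw₃ hB ρ c,
    real_sdiff_selector_eq_sum_patterns k m F hη hw₁ hw₂ hw₃ hB ρ c]

/-- **Defect form**: `P(E | σ on) − P(E | σ off) = ½ M(B set-pivotal) − 2^{-k} Σ_{J ⊆ [k]} M(A^J ∖ A^∅)`,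
where `{B set-pivotal} = {ω ∪ B ∈ Aloc, ω ∖ B ∉ Aloc}` and `A^∅ = {ω ∖ B ∈ Aloc} ⊆ A^J`. -/
theorem selectorInfl_eq_half_pivotal_sub_defect (k m : ℕ) (F : Fin m → Quad (Set.univ : Set ℂ))
    {η : ℝ} (hη : η ≠ 0) {t : Site 2} {d : Fin 2} {w : ℕ → Site 2}
    (hw₁ : ∀ j, j < k → ax k (w j, d) ∧ tb k (w j, d) = t)
    (hw₂ : ∀ v : Site 2, ax k (v, d) → tb k (v, d) = t → ∃ j, j < k ∧ v = w j)
    (hw₃ : ∀ j j', j < k → j' < k → w j = w j' → j = j')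
    {B : Finset (Sym2 (Site 2))} (hB : B = (Finset.range k).image fun j => edgeOf (w j, d))
    (ρ c : ℝ) :
    (prodBernoulli (prm k ρ c)).real {S | insert (t, d, (2 : Fin 3)) S ∈ (cfg k) ⁻¹' Aloc m F η} -
        (prodBernoulli (prm k ρ c)).real {S | S \ {(t, d, (2 : Fin 3))} ∈ (cfg k) ⁻¹' Aloc m F η} =
      1 / 2 * (M k ρ c).real {ω | ω ∪ ↑B ∈ Aloc m F η ∧ ω \ ↑B ∉ Aloc m F η} -
        (1 / 2) ^ k * ∑ J ∈ (Finset.range k).powerset,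
          (M k ρ c).real ({ω | ω \ ↑B ∪ ↑(J.image fun j => edgeOf (w j, d)) ∈ Aloc m F η} \
            {ω | ω \ ↑B ∈ Aloc m F η}) := by
  haveI := isProbabilityMeasure_M k ρ c
  have hA := isUpperSet_Aloc m F η
  have h0m : MeasurableSet {ω : BondConfig (Site 2) | ω \ ↑B ∈ Aloc m F η} := by
    simpa using measurableSet_section_bundle m F hη ↑B ∅
  -- every section contains the closed-bundle section
  have hsub : ∀ J : Finset ℕ, {ω : BondConfig (Site 2) | ω \ ↑B ∈ Aloc m F η} ⊆
      {ω | ω \ ↑B ∪ ↑(J.image fun j => edgeOf (w j, d)) ∈ Aloc m F η} :=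
    fun J ω hω => hA Set.subset_union_left hω
  have hsubB : {ω : BondConfig (Site 2) | ω \ ↑B ∈ Aloc m F η} ⊆ {ω | ω ∪ ↑B ∈ Aloc m F η} :=
    fun ω hω => hA (Set.sdiff_subset.trans Set.subset_union_left) hω
  have hpiv : {ω : BondConfig (Site 2) | ω ∪ ↑B ∈ Aloc m F η ∧ ω \ ↑B ∉ Aloc m F η} =
      {ω | ω ∪ ↑B ∈ Aloc m F η} \ {ω | ω \ ↑B ∈ Aloc m F η} := Set.ext fun _ => Iff.rfl
  have hdiff : ∀ J : Finset ℕ,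
      (M k ρ c).real {ω | ω \ ↑B ∪ ↑(J.image fun j => edgeOf (w j, d)) ∈ Aloc m F η} =
        (M k ρ c).real ({ω | ω \ ↑B ∪ ↑(J.image fun j => edgeOf (w j, d)) ∈ Aloc m F η} \
            {ω | ω \ ↑B ∈ Aloc m F η}) +
          (M k ρ c).real {ω | ω \ ↑B ∈ Aloc m F η} := fun J => by
    rw [measureReal_sdiff (hsub J) h0m]; ring
  have hdiffB : (M k ρ c).real {ω | ω ∪ ↑B ∈ Aloc m F η} =
      (M k ρ c).real {ω | ω ∪ ↑B ∈ Aloc m F η ∧ ω \ ↑B ∉ Aloc m F η} +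
        (M k ρ c).real {ω | ω \ ↑B ∈ Aloc m F η} := by
    rw [hpiv, measureReal_sdiff hsubB h0m]; ring
  have hk : (1 / 2 : ℝ) ^ k * 2 ^ k = 1 := by rw [← mul_pow]; norm_num
  rw [selectorInfl_eq_sections k m F hη hw₁ hw₂ hw₃ hB ρ c, Finset.sum_congr rfl fun J _ => hdiff J,
    Finset.sum_add_distrib, Finset.sum_const, Finset.card_powerset, Finset.card_range, nsmul_eq_mul,
    hdiffB]
  push_cast
  linear_combination (-(M k ρ c).real {ω | ω \ ↑B ∈ Aloc m F η}) * hk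

/-- **The sharp two-sided bound**: `|P(E | σ on) − P(E | σ off)| ≤ (½ − 2^{-k}) · M(B set-pivotal)`. -/
theorem abs_selectorInfl_le (k m : ℕ) (F : Fin m → Quad (Set.univ : Set ℂ)) {η : ℝ} (hη : η ≠ 0)
    {t : Site 2} {d : Fin 2} {w : ℕ → Site 2}
    (hw₁ : ∀ j, j < k → ax k (w j, d) ∧ tb k (w j, d) = t)
    (hw₂ : ∀ v : Site 2, ax k (v, d) → tb k (v, d) = t → ∃ j, j < k ∧ v = w j)
    (hw₃ : ∀ j j', j < k → j' < k → w j = w j' → j = j')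
    {B : Finset (Sym2 (Site 2))} (hB : B = (Finset.range k).image fun j => edgeOf (w j, d))
    (ρ c : ℝ) :
    |(prodBernoulli (prm k ρ c)).real {S | insert (t, d, (2 : Fin 3)) S ∈ (cfg k) ⁻¹' Aloc m F η} -
        (prodBernoulli (prm k ρ c)).real {S | S \ {(t, d, (2 : Fin 3))} ∈ (cfg k) ⁻¹' Aloc m F η}| ≤
      (1 / 2 - (1 / 2) ^ k) * (M k ρ c).real {ω | ω ∪ ↑B ∈ Aloc m F η ∧ ω \ ↑B ∉ Aloc m F η} := by
  classical
  haveI := isProbabilityMeasure_M k ρ c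
  have hA := isUpperSet_Aloc m F η
  set piv : ℝ := (M k ρ c).real {ω | ω ∪ ↑B ∈ Aloc m F η ∧ ω \ ↑B ∉ Aloc m F η} with hpiv
  set D : Finset ℕ → ℝ := fun J =>
    (M k ρ c).real ({ω | ω \ ↑B ∪ ↑(J.image fun j => edgeOf (w j, d)) ∈ Aloc m F η} \
      {ω | ω \ ↑B ∈ Aloc m F η}) with hD
  have hDnn : ∀ J, 0 ≤ D J := fun J => measureReal_nonneg
  have hDle : ∀ J ∈ (Finset.range k).powerset, D J ≤ piv := by
    intro J hJ
    refine measureReal_mono ?_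
    rintro ω ⟨h1, h2⟩
    refine ⟨hA ?_ h1, h2⟩
    refine Set.union_subset (Set.sdiff_subset.trans Set.subset_union_left) ?_
    refine Set.Subset.trans ?_ Set.subset_union_right
    rw [hB, Finset.coe_image, Finset.coe_image]
    exact Set.image_mono (Finset.coe_subset.2 (Finset.mem_powerset.1 hJ))
  have hDtop : D (Finset.range k) = piv := by
    simp only [hD, hpiv, ← hB, Set.sdiff_union_self]
    rfl
  have hDbot : D ∅ = 0 := by
    simp only [hD, Finset.image_empty, Finset.coe_empty, Set.union_empty, Set.sdiff_self, measureReal_empty]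
  have hk : (1 / 2 : ℝ) ^ k * 2 ^ k = 1 := by rw [← mul_pow]; norm_num
  have htop : (Finset.range k) ∈ (Finset.range k).powerset := Finset.mem_powerset.2 subset_rfl
  -- upper bound: keep only the full pattern
  have hup : piv ≤ ∑ J ∈ (Finset.range k).powerset, D J := by
    rw [← hDtop]
    exact Finset.single_le_sum (fun J _ => hDnn J) htop
  -- lower bound: drop the empty pattern, bound the others by `piv`
  have hlow : ∑ J ∈ (Finset.range k).powerset, D J ≤ (2 ^ k - 1) * piv := by
    rw [← Finset.sum_erase _ hDbot]
    have hcard : ((Finset.range k).powerset.erase ∅).card = 2 ^ k - 1 := by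
      rw [Finset.card_erase_of_mem (Finset.empty_mem_powerset _), Finset.card_powerset, Finset.card_range]
    calc ∑ J ∈ (Finset.range k).powerset.erase ∅, D J
        ≤ ((Finset.range k).powerset.erase ∅).card • piv :=
          Finset.sum_le_card_nsmul _ _ _ fun J hJ => hDle J (Finset.mem_of_mem_erase hJ)
      _ = (2 ^ k - 1) * piv := by
          rw [hcard, nsmul_eq_mul, Nat.cast_sub Nat.one_le_two_pow]
          push_cast
          ring
  have hpk : (0 : ℝ) ≤ (1 / 2) ^ k := by positivity
  have h1 : (1 / 2 : ℝ) ^ k * ∑ J ∈ (Finset.range k).powerset, D J ≤ piv - (1 / 2) ^ k * piv := by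
    have h := mul_le_mul_of_nonneg_left hlow hpk
    have e : (1 / 2 : ℝ) ^ k * ((2 ^ k - 1) * piv) = piv - (1 / 2) ^ k * piv := by
      linear_combination piv * hk
    linarith
  have h2 : (1 / 2 : ℝ) ^ k * piv ≤ (1 / 2) ^ k * ∑ J ∈ (Finset.range k).powerset, D J :=
    mul_le_mul_of_nonneg_left hup hpk
  rw [selectorInfl_eq_half_pivotal_sub_defect k m F hη hw₁ hw₂ hw₃ hB ρ c, abs_le]
  constructor
  · calc -((1 / 2 - (1 / 2) ^ k) * piv) = 1 / 2 * piv - (piv - (1 / 2) ^ k * piv) := by ring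
      _ ≤ 1 / 2 * piv - (1 / 2) ^ k * ∑ J ∈ (Finset.range k).powerset, D J := sub_le_sub_left h1 _
  · calc 1 / 2 * piv - (1 / 2) ^ k * ∑ J ∈ (Finset.range k).powerset, D J
        ≤ 1 / 2 * piv - (1 / 2) ^ k * piv := sub_le_sub_left h2 _
      _ = (1 / 2 - (1 / 2) ^ k) * piv := by ring

/-- **Equality case `+`**: if almost surely no PROPER pattern does better than the closed bundle
(`M(A^J ∖ A^∅) = 0` for `J ≠ [k]`; e.g. a bulk bundle on the slice `c = 0`, whose partial patterns
are dangling), the selector influence is `(½ − 2^{-k}) · M(B set-pivotal) ≥ 0`. -/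
theorem selectorInfl_eq_of_defect_zero (k m : ℕ) (F : Fin m → Quad (Set.univ : Set ℂ)) {η : ℝ}
    (hη : η ≠ 0) {t : Site 2} {d : Fin 2} {w : ℕ → Site 2}
    (hw₁ : ∀ j, j < k → ax k (w j, d) ∧ tb k (w j, d) = t)
    (hw₂ : ∀ v : Site 2, ax k (v, d) → tb k (v, d) = t → ∃ j, j < k ∧ v = w j)
    (hw₃ : ∀ j j', j < k → j' < k → w j = w j' → j = j')
    {B : Finset (Sym2 (Site 2))} (hB : B = (Finset.range k).image fun j => edgeOf (w j, d))
    (ρ c : ℝ)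
    (h0 : ∀ J ∈ (Finset.range k).powerset, J ≠ Finset.range k →
      (M k ρ c).real ({ω | ω \ ↑B ∪ ↑(J.image fun j => edgeOf (w j, d)) ∈ Aloc m F η} \
        {ω | ω \ ↑B ∈ Aloc m F η}) = 0) :
    (prodBernoulli (prm k ρ c)).real {S | insert (t, d, (2 : Fin 3)) S ∈ (cfg k) ⁻¹' Aloc m F η} -
        (prodBernoulli (prm k ρ c)).real {S | S \ {(t, d, (2 : Fin 3))} ∈ (cfg k) ⁻¹' Aloc m F η} =
      (1 / 2 - (1 / 2) ^ k) * (M k ρ c).real {ω | ω ∪ ↑B ∈ Aloc m F η ∧ ω \ ↑B ∉ Aloc m F η} := by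
  have htop : (Finset.range k) ∈ (Finset.range k).powerset := Finset.mem_powerset.2 subset_rfl
  rw [selectorInfl_eq_half_pivotal_sub_defect k m F hη hw₁ hw₂ hw₃ hB ρ c,
    Finset.sum_eq_single_of_mem _ htop fun J hJ hJne => h0 J hJ hJne]
  have hDtop : (M k ρ c).real ({ω | ω \ ↑B ∪ ↑((Finset.range k).image fun j => edgeOf (w j, d)) ∈
      Aloc m F η} \ {ω | ω \ ↑B ∈ Aloc m F η}) =
      (M k ρ c).real {ω | ω ∪ ↑B ∈ Aloc m F η ∧ ω \ ↑B ∉ Aloc m F η} := by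
    simp only [← hB, Set.sdiff_union_self]
    rfl
  rw [hDtop]
  ring

/-! ## The bound on `|∂ρP|` by the set-pivotality of the bundles (valid at `ρ = 1`) -/

/-- **`|∂ρP| ≤ (½ − 2^{-k}) · Σ_bundles M_k(bundle set-pivotal)`** (registered sub-goal of
`stub_cornerWindows`).  For `0 < k`, `η ≠ 0`, `ρ ∈ [0,1]` (the corner `ρ = 1` included: `∂ρP` is
the one-sided `derivWithin`), any `c`, and the coin Finset `K` of the window: `|∂ρP(ρ,c)|` is at most
`(½ − 2^{-k})` times the sum, over the selector coins `(t,d,2)` of the window, of the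
`M_k(ρ,c)`-probability that the bundle `(t,d)` — the axial edges of direction `d` and coarse base
`t` — is pivotal AS A SET for the localised joint crossing event (`ω ∪ bundle ∈ Aloc`,
`ω ∖ bundle ∉ Aloc`). -/
theorem abs_Drho_le_sum_bundlePivotal : ∀ (k m : ℕ), 0 < k → ∀ (F : Fin m → Quad (Set.univ : Set ℂ)) {η : ℝ}, η ≠ 0 → ∀ {ρ : ℝ}, ρ ∈ Set.Icc (0 : ℝ) 1 → ∀ (c : ℝ) (K : Finset (Site 2 × Fin 2 × Fin 3)), (↑K : Set (Site 2 × Fin 2 × Fin 3)) = coinWindow k (window m F η) → |Dρ k m F η (ρ, c)| ≤ (1 / 2 - (1 / 2) ^ k) * ∑ i ∈ K with i.2.2 = 2, (M k ρ c).real {ω | ω ∪ edgeOf '' {vd : Site 2 × Fin 2 | ax k vd ∧ tb k vd = i.1 ∧ vd.2 = i.2.1} ∈ Aloc m F η ∧ ω \ edgeOf '' {vd : Site 2 × Fin 2 | ax k vd ∧ tb k vd = i.1 ∧ vd.2 = i.2.1} ∉ Aloc m F η} := by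
  intro k m hk F η hη ρ hρ c K hK
  classical
  rw [stub_Drho_eq_signed_sum k m F hη hρ c K hK, Finset.mul_sum]
  refine (Finset.abs_sum_le_sum_abs _ _).trans (Finset.sum_le_sum fun i hi => ?_)
  obtain ⟨t, d, j⟩ := i
  have hj : j = 2 := (Finset.mem_filter.1 hi).2
  subst hj
  obtain ⟨w, hw₁, hw₂, hw₃⟩ := exists_bundle_param hk t d
  have hBset := coe_bundleFinset_eq_image k hw₁ hw₂ (B := (Finset.range k).image fun j => edgeOf (w j, d)) rfl
  dsimp only
  rw [← hBset]
  exact abs_selectorInfl_le k m F hη hw₁ hw₂ hw₃ rfl ρ c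

end Summit.CriticalPhenomena.CardyFormulaZ2.Theorems.CardySelfRefinement

end
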